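import Literature.Topology.FourManifolds.LevelNormalisation
import Literature.Topology.FourManifolds.HandleAttachmentSublevel
import Literature.Topology.FourManifolds.MorseProofs
import HarnessLib

/-!
# Level-normalised form of two handle attachments with diffeomorphic bases

Topic `Literature/Topology/FourManifolds` (fact seat
`provefact-Literature.Topology.FourManifolds.IsHandlebody.exists_diffeomorph_isBoundaryGluing_sphere`,
step F2b₁ of the Lickorish–Wallace DAG, riding on L1 `oneHandle_nonempty_diffeomorph`;
this file is the **interface between L1 as stated and the level-compatible handle-extension
machinery** of `HandleConjugation.lean` / `HandleStepAssembly.lean`).  Everything here is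
**proved**; no named facts.

L1 (`HandlebodyClassification.lean`; Kosinski 1993, VI (6.6), (11.4)(c), VII (2.2); Milnor 1965,
Thm. 3.13) compares `W₁' ⊇ W₁`, `W₂' ⊇ W₂`, each obtained by attaching one handle
(`IsHandleAttachment`), given an **arbitrary** diffeomorphism `W₁ ≅ W₂`.  By
`HandleAttachmentSublevel.lean` this is a diffeomorphism `Ψ₀ : {f ≤ a} ≅ {f' ≤ a'}` of regular
sublevel sets of the presenting Morse functions; the handle-extension step, however, wants a
diffeomorphism of sublevel sets *which preserves the levels* (near the top).  The level
normalisation of `LevelComparison.lean` → `LevelNormalisation.lean` provides exactly this, and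
here it is repackaged in the vocabulary of handle attachments
(`exists_levelPreserving_of_sublevel_diffeomorph`): from Morse functions `f`, `f'` adapted to the
boundaries of compact `M`, `M'` (dimension `n + 1 ≥ 2`), regular levels `a, a' < 1` above which
each has exactly one critical point, of indices `m`, `m'`, and any `Ψ₀ : {f ≤ a} ≅ {f' ≤ a'}`,
we get

* a Morse function `F` adapted to `∂M` **equal to `f` on `{a ≤ f}`** (so with the same top
  critical point, value and index, and the same germ there), and levels `b < a`, `b' < a'`
  (`b' - b = a' - a`) which are regular for `F`, `f'`, with the sublevel sets in the interior
  and exactly one critical point above them, of index `m`, resp. `m'` — i.e. **the same two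
  handle attachments, presented at lower levels**;
* **a diffeomorphism `Ψ₁ : {F ≤ b} ≅ {f' ≤ b'}` with `f' ∘ Ψ₁ = F + (b' - b)` everywhere**;
* and the transfer of connectedness of the level `{f = a}` to `{f' = a'}`.

## References

* J. Milnor, *Lectures on the h-cobordism theorem* (1965), Lemma 2.9, Thm. 3.4, proof of
  Thm. 3.13 (PDF pp. 18–19). [MilnorHCobordism1965]
* A. A. Kosinski, *Differential Manifolds* (1993), VI (6.6), §7, (11.4)(c), VII (2.2). [Kosinski1993]
* J. Milnor, *Morse theory* (1963), §2, Cor. 2.3, Thms. 3.1–3.2. [Milnor1963]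
-/

open scoped Manifold ContDiff Topology
open Set Function Filter Metric Real

noncomputable section

namespace Literature.Topology.FourManifolds

universe u

/-- Local notation: `ℍ n` is the model half-space `EuclideanHalfSpace n`. -/
local notation "ℍ " n:arg => EuclideanHalfSpace n

variable {n : ℕ} {M : Type u} [TopologicalSpace M] [T2Space M] [CompactSpace M]
  [ChartedSpace (ℍ (n + 1)) M] [IsManifold (𝓡∂ (n + 1)) ∞ M]
  {M' : Type u} [TopologicalSpace M'] [T2Space M'] [CompactSpace M']
  [ChartedSpace (ℍ (n + 1)) M'] [IsManifold (𝓡∂ (n + 1)) ∞ M']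

omit [T2Space M] [T2Space M'] in
/-- **A common gap below two regular levels**: for Morse functions `f`, `f'` on compact manifolds
and levels `a`, `a'` through no critical point there is `ε > 0` such that no critical value of
`f` lies in `[a - ε, a)` and none of `f'` in `[a' - ε, a')` (finitely many critical points,
`IsMorse.finite_criticalSet_holds`, Milnor 1963, Cor. 2.3). [cite: Milnor1963, Cor. 2.3] -/
theorem exists_common_gap {f : M → ℝ} (hf : IsMorse (𝓡∂ (n + 1)) f) {a : ℝ}
    {f' : M' → ℝ} (hf' : IsMorse (𝓡∂ (n + 1)) f') {a' : ℝ} :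
    ∃ ε > 0, (∀ x, IsMCriticalPt (𝓡∂ (n + 1)) f x → f x < a - ε ∨ a ≤ f x) ∧
      (∀ y, IsMCriticalPt (𝓡∂ (n + 1)) f' y → f' y < a' - ε ∨ a' ≤ f' y) := by
  -- gap for one function
  have key : ∀ {N : Type u} [TopologicalSpace N] [CompactSpace N] [ChartedSpace (ℍ (n + 1)) N]
      [IsManifold (𝓡∂ (n + 1)) ∞ N] {g : N → ℝ} (_ : IsMorse (𝓡∂ (n + 1)) g) (b : ℝ),
      ∃ ε > 0, ∀ x, IsMCriticalPt (𝓡∂ (n + 1)) g x → g x < b - ε ∨ b ≤ g x := by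
    intro N _ _ _ _ g hg b
    have hfin : (criticalSet (𝓡∂ (n + 1)) g).Finite := IsMorse.finite_criticalSet_holds hg
    set S : Set ℝ := g '' (criticalSet (𝓡∂ (n + 1)) g ∩ {x | g x < b}) with hS
    have hSfin : S.Finite := (hfin.inter_of_left _).image g
    by_cases hSe : S = ∅
    · refine ⟨1, one_pos, fun x hx => ?_⟩
      by_cases hxb : g x < b
      · exfalso
        have : g x ∈ S := ⟨x, ⟨hx, hxb⟩, rfl⟩
        rw [hSe] at this; exact this
      · exact Or.inr (not_lt.1 hxb)
    · have hSne : S.Nonempty := nonempty_iff_ne_empty.2 hSe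
      obtain ⟨m, hmS, hm⟩ := hSfin.exists_maximal hSne
      have hmb : m < b := by
        obtain ⟨x, ⟨-, hxb⟩, rfl⟩ := hmS; exact hxb
      refine ⟨(b - m) / 2, by linarith, fun x hx => ?_⟩
      by_cases hxb : g x < b
      · left
        have hxS : g x ∈ S := ⟨x, ⟨hx, hxb⟩, rfl⟩
        have : g x ≤ m := by
          by_contra h
          exact absurd (hm hxS (not_le.1 h).le) (not_le.1 h).not_ge
        linarith
      · exact Or.inr (not_lt.1 hxb)
  obtain ⟨ε₁, hε₁, h₁⟩ := key hf a
  obtain ⟨ε₂, hε₂, h₂⟩ := key hf' a'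
  refine ⟨min ε₁ ε₂, lt_min hε₁ hε₂, fun x hx => ?_, fun y hy => ?_⟩
  · rcases h₁ x hx with h | h
    · left; linarith [min_le_left ε₁ ε₂]
    · exact Or.inr h
  · rcases h₂ y hy with h | h
    · left; linarith [min_le_right ε₁ ε₂]
    · exact Or.inr h

/-- **`Ψ₀` carries the level `{f = a}` onto `{f' = a'}`**: connectedness transfers.
[cite: Milnor1963, Thm. 3.1] -/
theorem LevelComparison.isConnected_level' {k : ℕ} {N : Type u} [TopologicalSpace N] [ChartedSpace (ℍ (k + 1)) N]
    [IsManifold (𝓡∂ (k + 1)) ∞ N] {N' : Type u} [TopologicalSpace N'] [ChartedSpace (ℍ (k + 1)) N']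
    [IsManifold (𝓡∂ (k + 1)) ∞ N'] (c : LevelComparison k N N') (h : IsConnected (c.f ⁻¹' {c.a})) :
    IsConnected (c.f' ⁻¹' {c.a'}) := by
  letI := c.atlas.chartedSpace
  letI := c.atlas'.chartedSpace
  haveI := c.atlas.isManifold
  haveI := c.atlas'.isManifold
  -- the level `a` inside `{f ≤ a}` and its image
  have himage : c.f' ⁻¹' {c.a'} =
      (fun x : ↥(c.f ⁻¹' {c.a}) => ((c.Ψ₀ ⟨x.1, le_of_eq x.2⟩ : ↥(c.f' ⁻¹' Iic c.a')) : N')) '' univ := by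
    ext y
    simp only [mem_preimage, mem_singleton_iff, image_univ, mem_range]
    constructor
    · intro hy
      set x := c.Ψ₀.symm ⟨y, hy.le⟩ with hx
      have hxa : c.f x = c.a := by
        have := (c.apply_Ψ₀_eq_iff x).1 (by rw [hx, Diffeomorph.apply_symm_apply]; exact hy)
        exact this
      refine ⟨⟨x, hxa⟩, ?_⟩
      have : (⟨(x : N), le_of_eq hxa⟩ : ↥(c.f ⁻¹' Iic c.a)) = x := Subtype.ext rfl
      rw [this, hx, Diffeomorph.apply_symm_apply]
    · rintro ⟨x, rfl⟩
      exact (c.apply_Ψ₀_eq_iff _).2 x.2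
  rw [himage]
  haveI : ConnectedSpace ↥(c.f ⁻¹' {c.a}) := isConnected_iff_connectedSpace.1 h
  refine (isConnected_univ).image _ (Continuous.continuousOn ?_)
  have hval : Continuous (Subtype.val : ↥(c.f' ⁻¹' Iic c.a') → N') := continuous_subtype_val
  refine hval.comp (c.Ψ₀.continuous.comp ?_)
  exact Continuous.subtype_mk (continuous_subtype_val) _

omit [T2Space M] [CompactSpace M] [ChartedSpace (ℍ (n + 1)) M] [IsManifold (𝓡∂ (n + 1)) ∞ M] [T2Space M']
  [CompactSpace M'] [ChartedSpace (ℍ (n + 1)) M'] [IsManifold (𝓡∂ (n + 1)) ∞ M'] in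
/-- **A level-preserving diffeomorphism of sublevel sets carries level to level**: connectedness
of `{f' = b'}` gives connectedness of `{F = b}`. [folklore] -/
theorem isConnected_level_of_levelPreserving {F : M → ℝ} {f' : M' → ℝ} {b b' : ℝ}
    [cs : ChartedSpace (ℍ (n + 1)) ↥(F ⁻¹' Iic b)] [cs' : ChartedSpace (ℍ (n + 1)) ↥(f' ⁻¹' Iic b')]
    (Ψ₁ : ↥(F ⁻¹' Iic b) ≃ₘ⟮𝓡∂ (n + 1), 𝓡∂ (n + 1)⟯ ↥(f' ⁻¹' Iic b'))
    (hΨ : ∀ x : ↥(F ⁻¹' Iic b), f' (Ψ₁ x) = F x + (b' - b)) (h : IsConnected (f' ⁻¹' {b'})) :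
    IsConnected (F ⁻¹' {b}) := by
  have himage : F ⁻¹' {b} =
      (fun y : ↥(f' ⁻¹' {b'}) => ((Ψ₁.symm ⟨y.1, le_of_eq y.2⟩ : ↥(F ⁻¹' Iic b)) : M)) '' univ := by
    ext x
    simp only [mem_preimage, mem_singleton_iff, image_univ, mem_range]
    constructor
    · intro hx
      set y := Ψ₁ ⟨x, hx.le⟩ with hy
      have hyb : f' y = b' := by rw [hy, hΨ]; simp [hx]
      refine ⟨⟨y, hyb⟩, ?_⟩
      have : (⟨(y : M'), le_of_eq hyb⟩ : ↥(f' ⁻¹' Iic b')) = y := Subtype.ext rfl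
      rw [this, hy, Diffeomorph.symm_apply_apply]
    · rintro ⟨y, rfl⟩
      have h1 := hΨ (Ψ₁.symm ⟨y.1, le_of_eq y.2⟩)
      rw [Diffeomorph.apply_symm_apply] at h1
      have h2 : f' y = b' := y.2
      simp only at h1
      linarith
  rw [himage]
  haveI : ConnectedSpace ↥(f' ⁻¹' {b'}) := isConnected_iff_connectedSpace.1 h
  refine isConnected_univ.image _ (Continuous.continuousOn ?_)
  exact continuous_subtype_val.comp (Ψ₁.symm.continuous.comp (Continuous.subtype_mk continuous_subtype_val _))

omit [T2Space M] [CompactSpace M] [IsManifold (𝓡∂ (n + 1)) ∞ M] [ChartedSpace (ℍ (n + 1)) M] [TopologicalSpace M] in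
/-- **Levels below a regular level with a critical-value gap are connected if the level is**
(ambient regular interval theorem `exists_diffeomorph_image_sublevel_eq_of_isInteriorPoint`,
Milnor 1963, Thm. 3.1: a diffeomorphism of `M'` carries `{f' = a' - ε}` onto `{f' = a'}`).
[cite: Milnor1963, Thm. 3.1] -/
theorem isConnected_level_sub_of_gap {f' : M' → ℝ} (hf' : ContMDiff (𝓡∂ (n + 1)) 𝓘(ℝ, ℝ) ∞ f')
    {a' ε : ℝ} (hε : 0 < ε)
    (hgap' : ∀ y, IsMCriticalPt (𝓡∂ (n + 1)) f' y → f' y < a' - ε ∨ a' ≤ f' y)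
    (hreg' : ∀ p, f' p = a' → ¬ IsMCriticalPt (𝓡∂ (n + 1)) f' p)
    (hint' : ∀ p, f' p ≤ a' → (𝓡∂ (n + 1)).IsInteriorPoint p)
    (h : IsConnected (f' ⁻¹' {a'})) : IsConnected (f' ⁻¹' {a' - ε}) := by
  have hregI : ∀ x, f' x ∈ Icc (a' - ε) a' → mfderiv (𝓡∂ (n + 1)) 𝓘(ℝ, ℝ) f' x ≠ 0 := by
    intro x hx hc
    rcases eq_or_lt_of_le hx.2 with h1 | h1
    · exact hreg' x h1 hc
    · rcases hgap' x hc with h2 | h2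
      · linarith [hx.1]
      · linarith
  obtain ⟨δ, Φ, -, -, hlev, -⟩ := exists_diffeomorph_image_sublevel_eq_of_isInteriorPoint (I := 𝓡∂ (n + 1))
    hf' (a := a' - ε) (b := a') (by linarith) hregI (fun x hx => hint' x hx.2)
  have heq : f' ⁻¹' {a' - ε} = Φ.symm '' (f' ⁻¹' {a'}) := by
    rw [← hlev, ← image_comp]
    have : (Φ.symm ∘ Φ : M' → M') = id := by funext x; simp
    rw [this, image_id]
  rw [heq]
  exact h.image _ Φ.symm.continuous.continuousOn

/-- **Level-normalised form of two handle attachments with diffeomorphic bases** (Milnor 1965,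
proof of Thm. 3.13: "we may assume the diffeomorphism preserves levels near the boundary";
Kosinski 1993, VI §7, VII (2.2)).  Let `f`, `f'` be Morse functions adapted to the boundaries of
the compact manifolds with boundary `M`, `M'` of dimension `n + 1 ≥ 2`, `a, a' < 1` levels
through no critical point above which `f`, `f'` have exactly one critical point, of indices
`m`, `m'`, and let `Ψ₀ : {f ≤ a} ≅ {f' ≤ a'}` be **any** diffeomorphism of the sublevel sets
(structures `sublevelAtlas`).  Then there are a Morse function `F` adapted to `∂M` with `F = f` on
`{a ≤ f}`, levels `b < a`, `b' < a'` with `b' - b = a' - a`, regular for `F`, `f'`, with the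
sublevel sets `{F ≤ b}`, `{f' ≤ b'}` in the interior and exactly one critical point above each,
of index `m`, resp. `m'`, and **a diffeomorphism `Ψ₁ : {F ≤ b} ≅ {f' ≤ b'}` with
`f' (Ψ₁ x) = F x + (b' - b)` for all `x`**; if the level `{f = a}` is connected, so are the
new levels `{F = b}` and `{f' = b'}`. [cite: MilnorHCobordism1965, proof of Thm. 3.13] [cite: Kosinski1993, VII (2.2)] -/
theorem exists_levelPreserving_of_sublevel_diffeomorph (hn : 1 ≤ n) {m m' : ℕ}
    {f : M → ℝ} (hf : IsMorseAdapted (𝓡∂ (n + 1)) f) {a : ℝ} (ha : a < 1)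
    (hcrit : ∀ z, IsMCriticalPt (𝓡∂ (n + 1)) f z → f z ≠ a)
    (hex : ∃! z, IsMCriticalPt (𝓡∂ (n + 1)) f z ∧ a < f z)
    (hidx : ∀ z, IsMCriticalPt (𝓡∂ (n + 1)) f z → a < f z → morseIndex (𝓡∂ (n + 1)) f z = m)
    {f' : M' → ℝ} (hf' : IsMorseAdapted (𝓡∂ (n + 1)) f') {a' : ℝ} (ha' : a' < 1)
    (hcrit' : ∀ z, IsMCriticalPt (𝓡∂ (n + 1)) f' z → f' z ≠ a')
    (hex' : ∃! z, IsMCriticalPt (𝓡∂ (n + 1)) f' z ∧ a' < f' z)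
    (hidx' : ∀ z, IsMCriticalPt (𝓡∂ (n + 1)) f' z → a' < f' z → morseIndex (𝓡∂ (n + 1)) f' z = m')
    (hint : ∀ p, f p ≤ a → (𝓡∂ (n + 1)).IsInteriorPoint p)
    (hreg : ∀ p, f p = a → ¬ IsMCriticalPt (𝓡∂ (n + 1)) f p)
    (hint' : ∀ p, f' p ≤ a' → (𝓡∂ (n + 1)).IsInteriorPoint p)
    (hreg' : ∀ p, f' p = a' → ¬ IsMCriticalPt (𝓡∂ (n + 1)) f' p)
    (Ψ₀ : letI := (sublevelAtlas hf.isMorse.contMDiff a hint hreg).chartedSpace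
      letI := (sublevelAtlas hf'.isMorse.contMDiff a' hint' hreg').chartedSpace
      ↥(f ⁻¹' Iic a) ≃ₘ⟮𝓡∂ (n + 1), 𝓡∂ (n + 1)⟯ ↥(f' ⁻¹' Iic a')) :
    ∃ (F : M → ℝ) (b b' : ℝ) (hF : IsMorseAdapted (𝓡∂ (n + 1)) F)
      (hintb : ∀ p, F p ≤ b → (𝓡∂ (n + 1)).IsInteriorPoint p)
      (hregb : ∀ p, F p = b → ¬ IsMCriticalPt (𝓡∂ (n + 1)) F p)
      (hintb' : ∀ p, f' p ≤ b' → (𝓡∂ (n + 1)).IsInteriorPoint p)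
      (hregb' : ∀ p, f' p = b' → ¬ IsMCriticalPt (𝓡∂ (n + 1)) f' p),
      b < a ∧ b' < a' ∧ b' - b = a' - a ∧
      (∀ x, a ≤ f x → F x = f x) ∧
      (∀ z, IsMCriticalPt (𝓡∂ (n + 1)) F z → F z ≠ b) ∧
      (∃! z, IsMCriticalPt (𝓡∂ (n + 1)) F z ∧ b < F z) ∧
      (∀ z, IsMCriticalPt (𝓡∂ (n + 1)) F z → b < F z → morseIndex (𝓡∂ (n + 1)) F z = m) ∧
      (∀ z, IsMCriticalPt (𝓡∂ (n + 1)) f' z → f' z ≠ b') ∧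
      (∃! z, IsMCriticalPt (𝓡∂ (n + 1)) f' z ∧ b' < f' z) ∧
      (∀ z, IsMCriticalPt (𝓡∂ (n + 1)) f' z → b' < f' z → morseIndex (𝓡∂ (n + 1)) f' z = m') ∧
      (IsConnected (f ⁻¹' {a}) → IsConnected (F ⁻¹' {b}) ∧ IsConnected (f' ⁻¹' {b'})) ∧
      (letI := (sublevelAtlas hF.isMorse.contMDiff b hintb hregb).chartedSpace
       letI := (sublevelAtlas hf'.isMorse.contMDiff b' hintb' hregb').chartedSpace
       ∃ Ψ₁ : ↥(F ⁻¹' Iic b) ≃ₘ⟮𝓡∂ (n + 1), 𝓡∂ (n + 1)⟯ ↥(f' ⁻¹' Iic b'),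
         ∀ x : ↥(F ⁻¹' Iic b), f' (Ψ₁ x) = F x + (b' - b)) := by
  -- the comparison data
  obtain ⟨c, hcf, hca, hcf', hca', -⟩ := LevelComparison.exists (k := n) (M := M) (M' := M')
    hf.isMorse.contMDiff hint hreg hf'.isMorse.contMDiff hint' hreg' Ψ₀
  subst hcf hca hcf' hca'
  obtain ⟨B⟩ := c.nonempty_collarBound
  -- the gap
  obtain ⟨ε, hε, hgap, hgap'⟩ := exists_common_gap (a := c.a) (a' := c.a') hf.isMorse hf'.isMorse
  haveI : Nonempty M := by obtain ⟨z, -, -⟩ := hex; exact ⟨z⟩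
  haveI : Nonempty M' := by obtain ⟨z, -, -⟩ := hex'; exact ⟨z⟩
  -- the normalised function
  have hs₁ : 0 < c.normS B ε * exp (-B.L₀) := c.normS_mul_exp_pos B hε
  have hFM : IsMorse (𝓡∂ (n + 1)) (c.norm B ε) := c.isMorse_norm B hn hε hf.isMorse hf'.isMorse
  have hFeq : ∀ x, c.a ≤ c.f x → c.norm B ε x = c.f x := fun x hx => c.norm_eq_f_of_le B hε hx
  have hFad : IsMorseAdapted (𝓡∂ (n + 1)) (c.norm B ε) := by
    refine ⟨hFM, fun x hx => ?_, fun x hx => ?_⟩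
    · have h1 : c.f x = 1 := (hf.2.1 x hx).1
      have hgt : c.a - c.normS B ε * exp (-B.L₀) < c.f x := by linarith
      refine ⟨by rw [c.norm_eq_f B hgt.le, h1], fun hc => (hf.2.1 x hx).2 ?_⟩
      exact (c.isMCriticalPt_splice_iff_of_gt hgt).1 hc
    · have hlt : c.f x < 1 := hf.2.2 x hx
      by_cases hge : c.a - c.normS B ε * exp (-B.L₀) ≤ c.f x
      · rw [c.norm_eq_f B hge]; exact hlt
      · have hxa : c.f x ≤ c.a := by linarith [not_le.1 hge]
        have hG : c.G x ≤ c.a' := c.G_le x hxa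
        refine lt_of_le_of_lt (c.splice_le_max x) (max_lt hlt ?_)
        linarith
  -- the level-preserving diffeomorphism and the connectedness of the new levels
  set Ψ₁ := c.normDiffeomorph B hn hε hgap' with hΨ₁
  have hΨ₁lev : ∀ x, c.f' (Ψ₁ x) = c.norm B ε x + (c.a' - ε - (c.a - ε)) := fun x => by
    rw [hΨ₁, c.apply_normDiffeomorph]; ring
  have hconn : IsConnected (c.f ⁻¹' {c.a}) →
      IsConnected (c.norm B ε ⁻¹' {c.a - ε}) ∧ IsConnected (c.f' ⁻¹' {c.a' - ε}) := by
    intro h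
    have h' : IsConnected (c.f' ⁻¹' {c.a' - ε}) :=
      isConnected_level_sub_of_gap c.hf' hε hgap' c.hreg' c.hint' (c.isConnected_level' h)
    exact ⟨isConnected_level_of_levelPreserving (cs := (c.normAtlas B hn hε hgap').chartedSpace)
      (cs' := (c.normAtlas' hε hgap').chartedSpace) Ψ₁ hΨ₁lev h', h'⟩
  refine ⟨c.norm B ε, c.a - ε, c.a' - ε, hFad, c.normInt B hε, c.normReg B hn hε hgap', c.normInt' hε,
    c.normReg' hε hgap', by linarith, by linarith, by ring, hFeq, ?_, ?_, ?_, ?_, ?_, ?_, hconn, ?_⟩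
  · intro z hz hzb
    exact c.normReg B hn hε hgap' z hzb hz
  · obtain ⟨p, ⟨hpc, hpa⟩, huniq⟩ := hex
    refine ⟨p, ⟨(c.isMCriticalPt_norm_of_le B hε hpc hpa.le).1, by rw [hFeq p hpa.le]; linarith⟩,
      fun z hz => ?_⟩
    obtain ⟨hza, hzcf, -⟩ := c.isMCriticalPt_norm_of_lt B hn hε hgap hgap' hz.1 hz.2
    have hza' : c.a < c.f z := lt_of_le_of_ne hza fun h => hcrit z hzcf h.symm
    exact huniq z ⟨hzcf, hza'⟩
  · intro z hzc hzb
    obtain ⟨hza, hzcf, hev⟩ := c.isMCriticalPt_norm_of_lt B hn hε hgap hgap' hzc hzb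
    have hza' : c.a < c.f z := lt_of_le_of_ne hza fun h => hcrit z hzcf h.symm
    have hev' : c.norm B ε =ᶠ[𝓝 z] fun y => c.f y + 0 :=
      hev.trans (Eventually.of_forall fun y => (add_zero _).symm)
    unfold morseIndex
    rw [mhessian_congr_of_eventuallyEq_add_const hev']
    exact hidx z hzcf hza'
  · intro z hz hzb
    exact c.normReg' hε hgap' z hzb hz
  · obtain ⟨p, ⟨hpc, hpa⟩, huniq⟩ := hex'
    refine ⟨p, ⟨hpc, by linarith⟩, fun z hz => ?_⟩
    have hza : c.a' ≤ c.f' z := (hgap' z hz.1).resolve_left (by intro h; linarith [hz.2])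
    have hza' : c.a' < c.f' z := lt_of_le_of_ne hza fun h => hcrit' z hz.1 h.symm
    exact huniq z ⟨hz.1, hza'⟩
  · intro z hzc hzb
    have hza : c.a' ≤ c.f' z := (hgap' z hzc).resolve_left (by intro h; linarith)
    exact hidx' z hzc (lt_of_le_of_ne hza fun h => hcrit' z hzc h.symm)
  · exact ⟨Ψ₁, hΨ₁lev⟩

/-- **From the hypotheses of L1 to a level-preserving pair of handle attachments.**  Let `M ⊇ W₁`
and `M' ⊇ W₂` be obtained by attaching one handle each (`IsHandleAttachment n m W₁ M`,
`IsHandleAttachment n m' W₂ M'`, dimension `n + 1 ≥ 2`, `M`, `M'` compact) and let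
`e : W₁ ≅ W₂` be any diffeomorphism.  Then there are Morse functions `F`, `f'` adapted to the
boundaries of `M`, `M'`, regular levels `b, b' < 1` with the sublevel sets in the interior and
exactly one critical point above each, of indices `m`, `m'` — so `M`, `M'` are still obtained
from `{F ≤ b}`, `{f' ≤ b'}` by attaching one `m`-handle, resp. one `m'`-handle — **and a
diffeomorphism `Ψ₁ : {F ≤ b} ≅ {f' ≤ b'}` preserving the levels, `f' ∘ Ψ₁ = F + (b' - b)`**;
if `∂W₁` is connected, so are the levels `{F = b}`, `{f' = b'}`.  (Unpack the attachments to
sublevel sets, `IsHandleAttachment.exists_diffeomorph_sublevel`; transport `e`; normalise the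
levels, `exists_levelPreserving_of_sublevel_diffeomorph`.)  This is the form in which the
uniqueness of attaching a handle (Kosinski 1993, VI (6.6), VII (2.2); Milnor 1965, Thm. 3.13)
enters the level-compatible handle-extension step. [cite: MilnorHCobordism1965, proof of Thm. 3.13] [cite: Kosinski1993, VI (6.6) and VII (2.2)] -/
theorem IsHandleAttachment.exists_levelPreserving_pair (hn : 1 ≤ n) {m m' : ℕ}
    {W₁ : Type u} [TopologicalSpace W₁] [ChartedSpace (ℍ (n + 1)) W₁]
    {W₂ : Type u} [TopologicalSpace W₂] [ChartedSpace (ℍ (n + 1)) W₂]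
    (h₁ : IsHandleAttachment n m W₁ M) (h₂ : IsHandleAttachment n m' W₂ M')
    (e : W₁ ≃ₘ⟮𝓡∂ (n + 1), 𝓡∂ (n + 1)⟯ W₂) :
    ∃ (F : M → ℝ) (f' : M' → ℝ) (b b' : ℝ) (hF : IsMorseAdapted (𝓡∂ (n + 1)) F)
      (hf' : IsMorseAdapted (𝓡∂ (n + 1)) f')
      (hintb : ∀ p, F p ≤ b → (𝓡∂ (n + 1)).IsInteriorPoint p)
      (hregb : ∀ p, F p = b → ¬ IsMCriticalPt (𝓡∂ (n + 1)) F p)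
      (hintb' : ∀ p, f' p ≤ b' → (𝓡∂ (n + 1)).IsInteriorPoint p)
      (hregb' : ∀ p, f' p = b' → ¬ IsMCriticalPt (𝓡∂ (n + 1)) f' p),
      b < 1 ∧ b' < 1 ∧
      (∀ z, IsMCriticalPt (𝓡∂ (n + 1)) F z → F z ≠ b) ∧
      (∃! z, IsMCriticalPt (𝓡∂ (n + 1)) F z ∧ b < F z) ∧
      (∀ z, IsMCriticalPt (𝓡∂ (n + 1)) F z → b < F z → morseIndex (𝓡∂ (n + 1)) F z = m) ∧
      (∀ z, IsMCriticalPt (𝓡∂ (n + 1)) f' z → f' z ≠ b') ∧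
      (∃! z, IsMCriticalPt (𝓡∂ (n + 1)) f' z ∧ b' < f' z) ∧
      (∀ z, IsMCriticalPt (𝓡∂ (n + 1)) f' z → b' < f' z → morseIndex (𝓡∂ (n + 1)) f' z = m') ∧
      (IsConnected ((𝓡∂ (n + 1)).boundary W₁) → IsConnected (F ⁻¹' {b}) ∧ IsConnected (f' ⁻¹' {b'})) ∧
      (letI := (sublevelAtlas hF.isMorse.contMDiff b hintb hregb).chartedSpace
       letI := (sublevelAtlas hf'.isMorse.contMDiff b' hintb' hregb').chartedSpace
       ∃ Ψ₁ : ↥(F ⁻¹' Iic b) ≃ₘ⟮𝓡∂ (n + 1), 𝓡∂ (n + 1)⟯ ↥(f' ⁻¹' Iic b'),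
         ∀ x : ↥(F ⁻¹' Iic b), f' (Ψ₁ x) = F x + (b' - b)) := by
  obtain ⟨f, a, hf, hint, hreg, ha, hcrit, hex, hidx, ⟨e₁⟩⟩ := h₁.exists_diffeomorph_sublevel
  obtain ⟨f', a', hf', hint', hreg', ha', hcrit', hex', hidx', ⟨e₂⟩⟩ := h₂.exists_diffeomorph_sublevel
  letI := (sublevelAtlas hf.isMorse.contMDiff a hint hreg).chartedSpace
  letI := (sublevelAtlas hf'.isMorse.contMDiff a' hint' hreg').chartedSpace
  haveI := (sublevelAtlas hf.isMorse.contMDiff a hint hreg).isManifold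
  haveI := (sublevelAtlas hf'.isMorse.contMDiff a' hint' hreg').isManifold
  set Ψ₀ : ↥(f ⁻¹' Iic a) ≃ₘ⟮𝓡∂ (n + 1), 𝓡∂ (n + 1)⟯ ↥(f' ⁻¹' Iic a') := e₁.symm.trans (e.trans e₂) with hΨ₀
  obtain ⟨F, b, b', hF, hintb, hregb, hintb', hregb', hba, hba', -, -, h1, h2, h3, h4, h5, h6, hconn, hΨ⟩ :=
    exists_levelPreserving_of_sublevel_diffeomorph hn hf ha hcrit hex hidx hf' ha' hcrit' hex' hidx'
      hint hreg hint' hreg' Ψ₀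
  refine ⟨F, f', b, b', hF, hf', hintb, hregb, hintb', hregb', by linarith, by linarith, h1, h2, h3, h4, h5, h6,
    fun hb => hconn (isConnected_level_of_diffeomorph_sublevel hf.isMorse.contMDiff hint hreg e₁ hb), hΨ⟩

/-- **L1 from the level-preserving handle-extension step.**  The uniqueness of attaching one
`1`-handle, `Literature.Topology.FourManifolds.oneHandle_nonempty_diffeomorph` (Kosinski 1993,
VI (6.6), (11.4)(c), VII (2.2); Milnor 1965, Thm. 3.13), quantifies over an *arbitrary*
diffeomorphism `W₁ ≅ W₂` of the manifolds to which the handles are attached.  By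
`IsHandleAttachment.exists_levelPreserving_pair` it follows from the **level-preserving step**
spelled out as the hypothesis `H`: *compact Hausdorff second countable orientable `M`, `M'` of
dimension `n + 1 ≥ 3` with Morse functions `F`, `f'` adapted to the boundaries, regular levels
`b, b' < 1` with interior sublevel sets above which there is exactly one critical point, of
index `1`, the level `{F = b}` connected, and a diffeomorphism `{F ≤ b} ≅ {f' ≤ b'}` with
`f' ∘ Ψ₁ = F + (b' - b)`, are diffeomorphic* — the statement which the handle-extension
machinery of the tree (`HandleConjugation.lean`, `HandleExtensionDiffeo.lean`,
`HandleStepAssembly.lean`: Milnor's proof of Thm. 3.13 by flows and handle charts) is designed to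
deliver once the lower correspondence is matched with the chart map on the feet (two-disc
theorem in the level, `TwoDiscsDiffeotopy.lean`). [cite: Kosinski1993, VI (6.6), (11.4)(c) and VII (2.2)] [cite: MilnorHCobordism1965, Thm. 3.13] -/
theorem oneHandle_nonempty_diffeomorph_of_levelStep
    (H : ∀ (n : ℕ) (_ : 2 ≤ n) (M M' : Type u)
      [TopologicalSpace M] [T2Space M] [SecondCountableTopology M] [CompactSpace M]
      [ChartedSpace (ℍ (n + 1)) M] [IsManifold (𝓡∂ (n + 1)) ∞ M]
      [TopologicalSpace M'] [T2Space M'] [SecondCountableTopology M'] [CompactSpace M']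
      [ChartedSpace (ℍ (n + 1)) M'] [IsManifold (𝓡∂ (n + 1)) ∞ M']
      (F : M → ℝ) (f' : M' → ℝ) (b b' : ℝ) (hF : IsMorseAdapted (𝓡∂ (n + 1)) F)
      (hf' : IsMorseAdapted (𝓡∂ (n + 1)) f')
      (hintb : ∀ p, F p ≤ b → (𝓡∂ (n + 1)).IsInteriorPoint p)
      (hregb : ∀ p, F p = b → ¬ IsMCriticalPt (𝓡∂ (n + 1)) F p)
      (hintb' : ∀ p, f' p ≤ b' → (𝓡∂ (n + 1)).IsInteriorPoint p)
      (hregb' : ∀ p, f' p = b' → ¬ IsMCriticalPt (𝓡∂ (n + 1)) f' p),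
      b < 1 → b' < 1 →
      (∀ z, IsMCriticalPt (𝓡∂ (n + 1)) F z → F z ≠ b) →
      (∃! z, IsMCriticalPt (𝓡∂ (n + 1)) F z ∧ b < F z) →
      (∀ z, IsMCriticalPt (𝓡∂ (n + 1)) F z → b < F z → morseIndex (𝓡∂ (n + 1)) F z = 1) →
      (∀ z, IsMCriticalPt (𝓡∂ (n + 1)) f' z → f' z ≠ b') →
      (∃! z, IsMCriticalPt (𝓡∂ (n + 1)) f' z ∧ b' < f' z) →
      (∀ z, IsMCriticalPt (𝓡∂ (n + 1)) f' z → b' < f' z → morseIndex (𝓡∂ (n + 1)) f' z = 1) →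
      IsConnected (F ⁻¹' {b}) → IsOrientable (𝓡∂ (n + 1)) M → IsOrientable (𝓡∂ (n + 1)) M' →
      (letI := (sublevelAtlas hF.isMorse.contMDiff b hintb hregb).chartedSpace
       letI := (sublevelAtlas hf'.isMorse.contMDiff b' hintb' hregb').chartedSpace
       ∀ Ψ₁ : ↥(F ⁻¹' Iic b) ≃ₘ⟮𝓡∂ (n + 1), 𝓡∂ (n + 1)⟯ ↥(f' ⁻¹' Iic b'),
         (∀ x : ↥(F ⁻¹' Iic b), f' (Ψ₁ x) = F x + (b' - b)) →
         Nonempty (M ≃ₘ⟮𝓡∂ (n + 1), 𝓡∂ (n + 1)⟯ M'))) :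
    oneHandle_nonempty_diffeomorph.{u} := by
  intro n hn W₁ W₂ W₁' W₂' _ _ _ _ _ _ _ _ _ _ _ _ _ _ _ _ _ _ _ _ _ _ _ _ h₁ h₂ hb ho₁ ho₂ e
  obtain ⟨F, f', b, b', hF, hf', hintb, hregb, hintb', hregb', hb1, hb1', h1, h2, h3, h4, h5, h6, hconn, Ψ₁, hΨ₁⟩ :=
    IsHandleAttachment.exists_levelPreserving_pair (M := W₁') (M' := W₂') (by omega) h₁ h₂ e
  exact H n hn W₁' W₂' F f' b b' hF hf' hintb hregb hintb' hregb' hb1 hb1' h1 h2 h3 h4 h5 h6 (hconn hb).1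
    ho₁ ho₂ Ψ₁ hΨ₁

end Literature.Topology.FourManifolds

end
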